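/-
Copyright: the b2b-balaban T⁴-continuum CRUX team, row NE7b OWNER lineage `t4-ne7b-p1` (gen 141). Project licence.
-/
import Summits.QuantumFields.BalabanUV.T4Continuum.Spine.NE7b.SupTiltedScalarMomentCalculus

/-!
# THE CONSTITUENTS OF `∂³W` AS SCALAR TILTED MOMENTS AND THEIR `ψ`-DERIVATIVES: `Z`, `G_v`, `H_{vw}` (SCOPING (d13)(2): the cumulant FORM of
# `∂⁴W`, second file).  (472) wrote `T(ψ)[h,k,l]` with the scalar integrals `Z = ∫e^{−U}`, `G_v = ∫e^{−U}U′v`, `H_{vw} = ∫e^{−U}(U″vw − U′vU′w)`,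
# `Φ_{hkl} = ∫e^{−U}(U‴hkl − …)` (all at `ω+ψ`, against `N(0,Γ)`).  (513)'s engine differentiates each once the observable is `C¹` with
# polynomial growth in `‖U′‖`; this file supplies the entry observables' calculus — `φ ↦ U′φ v` has derivative `ev_v ∘ U″φ` (norm
# `≤ ‖v‖‖U″φ‖`), `φ ↦ U″φ v w` has derivative `(ev_w ∘ ev_v) ∘ U‴φ` — and the first three ENDS, for directions of norm `≤ 1`:
#   `d_m Z = −∫e^{−U}U′m = −G_m`,   `d_m G_v = ∫e^{−U}(U″mv − U′v·U′m) = H_{mv}`,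
#   `d_m H_{vw} = ∫e^{−U}(U‴mvw − U″mv·U′w − U′v·U″mw − (U″vw − U′vU′w)U′m) = Φ_{mvw}`
# as `HasFDerivAt` statements at EVERY `ψ₀` with the applied forms — (402)∕(418)'s `Z′ = −G`, `G′ = H`, `H′ = ∫Φ` in scalar clothing, for a
# general `Γ ⪰ 0` under the regulator (row NE7b, node U5c; (513) `hasFDerivAt_tilted_moment`, `tilted_moment_fderiv_apply` BY NAME; [folklore])

Cell `pub-balaban`, sub-cell `t4`, spine estimate NE7b (`T4WeightBudget.RelWeightBound`; the cell's OWN estimate — NOT PRINTED in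
[Bałaban 1983–89], NOT PROVED).  Crux-route work under `Spine/NE7b/` by the row OWNER (`t4-ne7b-p1` gen 141, file (514)) under FREEZE
(0)'s crux-prover clause; NOTHING of Bałaban's is named as a Lean object, valued or asserted; no `T4Continuum/Support` leaf typed; no
`def`, no notation; zero `sorry`.  Imports (BY NAME): the OWNER's (513) `…SupTiltedScalarMomentCalculus` (`hasFDerivAt_tilted_moment`,
`tilted_moment_fderiv_apply`, `integrable_weighted_moment`).

WHAT IS PROVED ([folklore]):
* §1 `hasFDerivAt_entry_one`, `hasFDerivAt_entry_two`, `norm_eval_comp_one_le`, `norm_eval_comp_two_le`, `abs_entry_one_le`, `abs_entry_two_le`.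
* §2 the observables `1`, `U′·v`, `U″vw − U′vU′w`: `C¹` with growth `(1+κ₂)(1+‖U′‖)`, `(1+2κ₂+κ₃)(1+‖U′‖)²`.
* §3 THE ENDS **`hasFDerivAt_Z_scalar`**, **`Z_fderiv_apply`**, **`hasFDerivAt_G_scalar`**, **`G_fderiv_apply`**, **`hasFDerivAt_H_scalar`**,
  **`H_fderiv_apply`**; §4 toy.

HONEST (what this is NOT).  Three of the four constituents; `Φ_{hkl}` (growth `(1+‖U′‖)³`, needs `U ∈ C⁴`) and the entries of `∂⁴W` by the
quotient rule on (472)'s formula are the next files; the centred regrouping and the assembly after them.  Scalar skeleton ((A3), NC-NE7b-α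
UNRULED); nothing of Bałaban's asserted.  BY-NAME EFFECT ON THE WALL: NONE.  NE7b NOT PRINTED ∕ NOT PROVED; spine PROVED 0∕9; rung (B)+1 —
the programme's measures remain FINITE-torus statements; NOT the mass gap, NOT Clay.  HONEST DEPENDENCY: continuum YM on T⁴ ⇐ BetaPertH ∧
nine spine estimates (0∕9 proved); BetaPertH ⇐ (D1) ∧ (D4) ∧ CAP+tail; G-an2-4 gates asym, D1 and NE2∕3∕4.
-/

set_option autoImplicit false
set_option maxSynthPendingDepth 3

noncomputable section

namespace Summit.QuantumFields.BalabanUV.T4Continuum.NE7b.SupTiltedMomentConstituents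

open MeasureTheory ProbabilityTheory Finset Real Metric Filter
open scoped BigOperators Topology
open SupTiltedScalarMomentCalculus (hasFDerivAt_tilted_moment tilted_moment_fderiv_apply integrable_weighted_moment)

variable {ι : Type} [Fintype ι] [DecidableEq ι]

/-! ## §1. The entry observables' calculus -/

section Entries

variable {U' : EuclideanSpace ℝ ι → EuclideanSpace ℝ ι →L[ℝ] ℝ} {U'' : EuclideanSpace ℝ ι → EuclideanSpace ℝ ι →L[ℝ] EuclideanSpace ℝ ι →L[ℝ] ℝ}
  {U₃ : EuclideanSpace ℝ ι → EuclideanSpace ℝ ι →L[ℝ] EuclideanSpace ℝ ι →L[ℝ] EuclideanSpace ℝ ι →L[ℝ] ℝ}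

omit [DecidableEq ι] in
/-- `φ ↦ U′φ v` has derivative `ev_v ∘ U″φ`. [folklore] -/
theorem hasFDerivAt_entry_one (hU'd : ∀ φ : EuclideanSpace ℝ ι, HasFDerivAt U' (U'' φ) φ) (v φ : EuclideanSpace ℝ ι) :
    HasFDerivAt (fun φ : EuclideanSpace ℝ ι => U' φ v) ((ContinuousLinearMap.apply ℝ ℝ v).comp (U'' φ)) φ := by
  have h := (ContinuousLinearMap.apply ℝ ℝ v).hasFDerivAt.comp φ (hU'd φ)
  simpa [Function.comp_def] using h

omit [DecidableEq ι] in
/-- `φ ↦ U″φ v w` has derivative `(ev_w ∘ ev_v) ∘ U‴φ`. [folklore] -/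
theorem hasFDerivAt_entry_two (hU''d : ∀ φ : EuclideanSpace ℝ ι, HasFDerivAt U'' (U₃ φ) φ) (v w φ : EuclideanSpace ℝ ι) :
    HasFDerivAt (fun φ : EuclideanSpace ℝ ι => U'' φ v w) (((ContinuousLinearMap.apply ℝ ℝ w).comp (ContinuousLinearMap.apply ℝ (EuclideanSpace ℝ ι
        →L[ℝ] ℝ) v)).comp (U₃ φ)) φ := by
  have h := ((ContinuousLinearMap.apply ℝ ℝ w).comp (ContinuousLinearMap.apply ℝ (EuclideanSpace ℝ ι →L[ℝ] ℝ) v)).hasFDerivAt.comp φ (hU''d φ)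
  simpa [Function.comp_def] using h

omit [DecidableEq ι] in
/-- `‖ev_v ∘ T‖ ≤ ‖v‖‖T‖`. [folklore] -/
theorem norm_eval_comp_one_le (T : EuclideanSpace ℝ ι →L[ℝ] EuclideanSpace ℝ ι →L[ℝ] ℝ) (v : EuclideanSpace ℝ ι) :
    ‖(ContinuousLinearMap.apply ℝ ℝ v).comp T‖ ≤ ‖v‖ * ‖T‖ := by
  refine ContinuousLinearMap.opNorm_le_bound _ (by positivity) fun u => ?_
  simp only [ContinuousLinearMap.coe_comp, Function.comp_apply, ContinuousLinearMap.apply_apply]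
  calc ‖T u v‖ ≤ ‖T u‖ * ‖v‖ := ContinuousLinearMap.le_opNorm _ _
    _ ≤ ‖T‖ * ‖u‖ * ‖v‖ := mul_le_mul_of_nonneg_right (ContinuousLinearMap.le_opNorm _ _) (norm_nonneg _)
    _ = ‖v‖ * ‖T‖ * ‖u‖ := by ring

omit [DecidableEq ι] in
/-- `‖(ev_w ∘ ev_v) ∘ T‖ ≤ ‖v‖‖w‖‖T‖`. [folklore] -/
theorem norm_eval_comp_two_le (T : EuclideanSpace ℝ ι →L[ℝ] EuclideanSpace ℝ ι →L[ℝ] EuclideanSpace ℝ ι →L[ℝ] ℝ) (v w : EuclideanSpace ℝ ι) :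
    ‖((ContinuousLinearMap.apply ℝ ℝ w).comp (ContinuousLinearMap.apply ℝ (EuclideanSpace ℝ ι →L[ℝ] ℝ) v)).comp T‖ ≤ ‖v‖ * ‖w‖ * ‖T‖ := by
  refine ContinuousLinearMap.opNorm_le_bound _ (by positivity) fun u => ?_
  simp only [ContinuousLinearMap.coe_comp, Function.comp_apply, ContinuousLinearMap.apply_apply]
  calc ‖T u v w‖ ≤ ‖T u v‖ * ‖w‖ := ContinuousLinearMap.le_opNorm _ _
    _ ≤ ‖T u‖ * ‖v‖ * ‖w‖ := mul_le_mul_of_nonneg_right (ContinuousLinearMap.le_opNorm _ _) (norm_nonneg _)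
    _ ≤ ‖T‖ * ‖u‖ * ‖v‖ * ‖w‖ := mul_le_mul_of_nonneg_right (mul_le_mul_of_nonneg_right (ContinuousLinearMap.le_opNorm _ _) (norm_nonneg _))
        (norm_nonneg _)
    _ = ‖v‖ * ‖w‖ * ‖T‖ * ‖u‖ := by ring

omit [DecidableEq ι] in
/-- `|U′φ v| ≤ ‖U′φ‖‖v‖`. [folklore] -/
theorem abs_entry_one_le (T : EuclideanSpace ℝ ι →L[ℝ] ℝ) (v : EuclideanSpace ℝ ι) : |T v| ≤ ‖T‖ * ‖v‖ := by
  rw [← Real.norm_eq_abs]; exact ContinuousLinearMap.le_opNorm _ _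

omit [DecidableEq ι] in
/-- `|U″φ v w| ≤ ‖U″φ‖‖v‖‖w‖`. [folklore] -/
theorem abs_entry_two_le (T : EuclideanSpace ℝ ι →L[ℝ] EuclideanSpace ℝ ι →L[ℝ] ℝ) (v w : EuclideanSpace ℝ ι) : |T v w| ≤ ‖T‖ * ‖v‖ * ‖w‖ := by
  rw [← Real.norm_eq_abs]
  exact (ContinuousLinearMap.le_opNorm _ _).trans (mul_le_mul_of_nonneg_right (ContinuousLinearMap.le_opNorm _ _) (norm_nonneg _))

end Entries

/-! ## §2–3. The observables `1`, `U′v`, `U″vw − U′vU′w` and THE ENDS -/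

section TheEnds

variable {Γ : Matrix ι ι ℝ} {γop : ℝ} {U : EuclideanSpace ℝ ι → ℝ} {U' : EuclideanSpace ℝ ι → EuclideanSpace ℝ ι →L[ℝ] ℝ}
  {U'' : EuclideanSpace ℝ ι → EuclideanSpace ℝ ι →L[ℝ] EuclideanSpace ℝ ι →L[ℝ] ℝ}
  {U₃ : EuclideanSpace ℝ ι → EuclideanSpace ℝ ι →L[ℝ] EuclideanSpace ℝ ι →L[ℝ] EuclideanSpace ℝ ι →L[ℝ] ℝ} {κ₀ κ₁ κ₂ κ₃ a τ δ θ : ℝ}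

/-- **`d_m Z`**: `HasFDerivAt Z (∫e^{−U}•(0 − 1•U′)) ψ₀` (the observable `p = 1`). [folklore] -/
theorem hasFDerivAt_Z_scalar (hΓ : Γ.PosSemidef) (hΓop : (γop • (1 : Matrix ι ι ℝ) - Γ).PosSemidef) (Y : Finset ι)
    (hUd : ∀ φ : EuclideanSpace ℝ ι, HasFDerivAt U (U' φ) φ) (hU'c : Continuous U') (hκ₀ : 0 ≤ κ₀) (hκ₁ : 0 ≤ κ₁) (ha : 0 ≤ a) (hτ : 0 < τ) (hδ : 0 <
        δ) (hθ1 : θ < 1) (hκθ : (2 * κ₀ * (1 + τ) + 4 * δ) * γop ≤ θ)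
    (hstab : ∀ φ : EuclideanSpace ℝ ι, -(κ₀ * ∑ x ∈ Y, φ x ^ 2) ≤ U φ) (hU'b : ∀ φ : EuclideanSpace ℝ ι, ‖U' φ‖ ≤ κ₁ * (a + ∑ x ∈ Y, φ x ^ 2)) (ψ₀ :
        EuclideanSpace ℝ ι) :
    HasFDerivAt (fun ψ : EuclideanSpace ℝ ι => ∫ ω : EuclideanSpace ℝ ι, exp (-U (ω + ψ)) * (1 : ℝ) ∂(multivariateGaussian 0 Γ))
      (∫ ω : EuclideanSpace ℝ ι, exp (-U (ω + ψ₀)) • ((0 : EuclideanSpace ℝ ι →L[ℝ] ℝ) - (1 : ℝ) • U' (ω + ψ₀)) ∂(multivariateGaussian 0 Γ)) ψ₀ :=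
  hasFDerivAt_tilted_moment (p := fun _ => (1 : ℝ)) (p' := fun _ => (0 : EuclideanSpace ℝ ι →L[ℝ] ℝ)) (Cp := 1) (n := 0) hΓ hΓop Y hUd hU'c
    (fun φ => hasFDerivAt_const (1 : ℝ) φ) continuous_const hκ₀ hκ₁ ha hτ hδ hθ1 hκθ hstab hU'b (fun φ => by simp) (fun φ => by simp) ψ₀

/-- **`(d_m Z) = −∫e^{−U}U′m = −G_m`**. [folklore] -/
theorem Z_fderiv_apply (hΓ : Γ.PosSemidef) (hΓop : (γop • (1 : Matrix ι ι ℝ) - Γ).PosSemidef) (Y : Finset ι)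
    (hUd : ∀ φ : EuclideanSpace ℝ ι, HasFDerivAt U (U' φ) φ) (hU'c : Continuous U') (hκ₀ : 0 ≤ κ₀) (hκ₁ : 0 ≤ κ₁) (ha : 0 ≤ a) (hτ : 0 < τ) (hδ : 0 <
        δ) (hθ1 : θ < 1) (hκθ : (2 * κ₀ * (1 + τ) + 4 * δ) * γop ≤ θ)
    (hstab : ∀ φ : EuclideanSpace ℝ ι, -(κ₀ * ∑ x ∈ Y, φ x ^ 2) ≤ U φ) (hU'b : ∀ φ : EuclideanSpace ℝ ι, ‖U' φ‖ ≤ κ₁ * (a + ∑ x ∈ Y, φ x ^ 2)) (ψ₀ m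
        : EuclideanSpace ℝ ι) :
    (∫ ω : EuclideanSpace ℝ ι, exp (-U (ω + ψ₀)) • ((0 : EuclideanSpace ℝ ι →L[ℝ] ℝ) - (1 : ℝ) • U' (ω + ψ₀)) ∂(multivariateGaussian 0 Γ)) m =
      -(∫ ω : EuclideanSpace ℝ ι, exp (-U (ω + ψ₀)) * U' (ω + ψ₀) m ∂(multivariateGaussian 0 Γ)) := by
  rw [tilted_moment_fderiv_apply (p := fun _ => (1 : ℝ)) (p' := fun _ => (0 : EuclideanSpace ℝ ι →L[ℝ] ℝ)) (Cp := 1) (n := 0) hΓ hΓop Y hUd hU'c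
    (fun φ => hasFDerivAt_const (1 : ℝ) φ) continuous_const hκ₀ hκ₁ ha hτ hδ hθ1 hκθ hstab hU'b (fun φ => by simp) (fun φ => by simp) ψ₀ m, ←
        integral_neg]
  refine integral_congr_ae (ae_of_all _ fun ω => ?_)
  simp only [zero_apply, one_mul, zero_sub, mul_neg]

/-- **`d_m G_v`** for `‖v‖ ≤ 1`: the observable `U′·v` is `C¹` with growth `(1+κ₂)(1+‖U′‖)`. [folklore] -/
theorem hasFDerivAt_G_scalar (hΓ : Γ.PosSemidef) (hΓop : (γop • (1 : Matrix ι ι ℝ) - Γ).PosSemidef) (Y : Finset ι)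
    (hUd : ∀ φ : EuclideanSpace ℝ ι, HasFDerivAt U (U' φ) φ) (hU'd : ∀ φ : EuclideanSpace ℝ ι, HasFDerivAt U' (U'' φ) φ) (hU''c : Continuous U'')
    (hκ₀ : 0 ≤ κ₀) (hκ₁ : 0 ≤ κ₁) (ha : 0 ≤ a) (hτ : 0 < τ) (hδ : 0 < δ) (hθ1 : θ < 1) (hκθ : (2 * κ₀ * (1 + τ) + 4 * δ) * γop ≤ θ)
    (hstab : ∀ φ : EuclideanSpace ℝ ι, -(κ₀ * ∑ x ∈ Y, φ x ^ 2) ≤ U φ) (hU'b : ∀ φ : EuclideanSpace ℝ ι, ‖U' φ‖ ≤ κ₁ * (a + ∑ x ∈ Y, φ x ^ 2)) (hU''b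
        : ∀ φ : EuclideanSpace ℝ ι, ‖U'' φ‖ ≤ κ₂)
    (ψ₀ v : EuclideanSpace ℝ ι) (hv : ‖v‖ ≤ 1) :
    HasFDerivAt (fun ψ : EuclideanSpace ℝ ι => ∫ ω : EuclideanSpace ℝ ι, exp (-U (ω + ψ)) * U' (ω + ψ) v ∂(multivariateGaussian 0 Γ))
      (∫ ω : EuclideanSpace ℝ ι, exp (-U (ω + ψ₀)) • (((ContinuousLinearMap.apply ℝ ℝ v).comp (U'' (ω + ψ₀))) - U' (ω + ψ₀) v • U' (ω + ψ₀))
          ∂(multivariateGaussian 0 Γ)) ψ₀ := by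
  have hU'c : Continuous U' := continuous_iff_continuousAt.2 fun φ => (hU'd φ).continuousAt
  have hκ₂ : 0 ≤ κ₂ := (norm_nonneg (U'' ψ₀)).trans (hU''b ψ₀)
  refine hasFDerivAt_tilted_moment (p := fun φ => U' φ v) (p' := fun φ => ((ContinuousLinearMap.apply ℝ ℝ v).comp (U'' φ))) (Cp := 1 + κ₂) (n := 1)
      hΓ hΓop Y hUd hU'c
    (fun φ => hasFDerivAt_entry_one hU'd v φ) (continuous_const.clm_comp hU''c) hκ₀ hκ₁ ha hτ hδ hθ1 hκθ hstab hU'b (fun φ => ?_) (fun φ => ?_) ψ₀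
  · calc |U' φ v| ≤ ‖U' φ‖ * ‖v‖ := abs_entry_one_le _ _
      _ ≤ ‖U' φ‖ * 1 := mul_le_mul_of_nonneg_left hv (norm_nonneg _)
      _ ≤ (1 + κ₂) * (1 + ‖U' φ‖) ^ 1 := by rw [pow_one]; nlinarith [norm_nonneg (U' φ)]
  · calc ‖((ContinuousLinearMap.apply ℝ ℝ v).comp (U'' φ))‖ ≤ ‖v‖ * ‖U'' φ‖ := norm_eval_comp_one_le _ _
      _ ≤ 1 * κ₂ := mul_le_mul hv (hU''b φ) (norm_nonneg _) zero_le_one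
      _ ≤ (1 + κ₂) * (1 + ‖U' φ‖) ^ 1 := by rw [pow_one]; nlinarith [norm_nonneg (U' φ)]

/-- **`(d_m G_v) = ∫e^{−U}(U″mv − U′v·U′m) = H_{mv}`**. [folklore] -/
theorem G_fderiv_apply (hΓ : Γ.PosSemidef) (hΓop : (γop • (1 : Matrix ι ι ℝ) - Γ).PosSemidef) (Y : Finset ι)
    (hUd : ∀ φ : EuclideanSpace ℝ ι, HasFDerivAt U (U' φ) φ) (hU'd : ∀ φ : EuclideanSpace ℝ ι, HasFDerivAt U' (U'' φ) φ) (hU''c : Continuous U'')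
    (hκ₀ : 0 ≤ κ₀) (hκ₁ : 0 ≤ κ₁) (ha : 0 ≤ a) (hτ : 0 < τ) (hδ : 0 < δ) (hθ1 : θ < 1) (hκθ : (2 * κ₀ * (1 + τ) + 4 * δ) * γop ≤ θ)
    (hstab : ∀ φ : EuclideanSpace ℝ ι, -(κ₀ * ∑ x ∈ Y, φ x ^ 2) ≤ U φ) (hU'b : ∀ φ : EuclideanSpace ℝ ι, ‖U' φ‖ ≤ κ₁ * (a + ∑ x ∈ Y, φ x ^ 2)) (hU''b
        : ∀ φ : EuclideanSpace ℝ ι, ‖U'' φ‖ ≤ κ₂)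
    (ψ₀ v : EuclideanSpace ℝ ι) (hv : ‖v‖ ≤ 1) (m : EuclideanSpace ℝ ι) :
    (∫ ω : EuclideanSpace ℝ ι, exp (-U (ω + ψ₀)) • (((ContinuousLinearMap.apply ℝ ℝ v).comp (U'' (ω + ψ₀))) - U' (ω + ψ₀) v • U' (ω + ψ₀))
        ∂(multivariateGaussian 0 Γ)) m =
      ∫ ω : EuclideanSpace ℝ ι, exp (-U (ω + ψ₀)) * (U'' (ω + ψ₀) m v - U' (ω + ψ₀) v * U' (ω + ψ₀) m) ∂(multivariateGaussian 0 Γ) := by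
  have hU'c : Continuous U' := continuous_iff_continuousAt.2 fun φ => (hU'd φ).continuousAt
  have hκ₂ : 0 ≤ κ₂ := (norm_nonneg (U'' ψ₀)).trans (hU''b ψ₀)
  rw [tilted_moment_fderiv_apply (p := fun φ => U' φ v) (p' := fun φ => ((ContinuousLinearMap.apply ℝ ℝ v).comp (U'' φ))) (Cp := 1 + κ₂) (n := 1) hΓ
      hΓop Y hUd hU'c
    (fun φ => hasFDerivAt_entry_one hU'd v φ) (continuous_const.clm_comp hU''c) hκ₀ hκ₁ ha hτ hδ hθ1 hκθ hstab hU'b (fun φ => ?_) (fun φ => ?_) ψ₀ m]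
  · refine integral_congr_ae (ae_of_all _ fun ω => ?_)
    simp only [ContinuousLinearMap.coe_comp, Function.comp_apply, ContinuousLinearMap.apply_apply]
  · calc |U' φ v| ≤ ‖U' φ‖ * ‖v‖ := abs_entry_one_le _ _
      _ ≤ ‖U' φ‖ * 1 := mul_le_mul_of_nonneg_left hv (norm_nonneg _)
      _ ≤ (1 + κ₂) * (1 + ‖U' φ‖) ^ 1 := by rw [pow_one]; nlinarith [norm_nonneg (U' φ)]
  · calc ‖((ContinuousLinearMap.apply ℝ ℝ v).comp (U'' φ))‖ ≤ ‖v‖ * ‖U'' φ‖ := norm_eval_comp_one_le _ _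
      _ ≤ 1 * κ₂ := mul_le_mul hv (hU''b φ) (norm_nonneg _) zero_le_one
      _ ≤ (1 + κ₂) * (1 + ‖U' φ‖) ^ 1 := by rw [pow_one]; nlinarith [norm_nonneg (U' φ)]

omit [DecidableEq ι] in
/-- The observable `U″vw − U′vU′w` is `C¹`: derivative `(ev_w∘ev_v)∘U‴ − (U′v•(ev_w∘U″) + U′w•(ev_v∘U″))`. [folklore] -/
theorem hasFDerivAt_obs_two (hU'd : ∀ φ : EuclideanSpace ℝ ι, HasFDerivAt U' (U'' φ) φ) (hU''d : ∀ φ : EuclideanSpace ℝ ι, HasFDerivAt U'' (U₃ φ) φ)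
    (v w φ : EuclideanSpace ℝ ι) :
    HasFDerivAt (fun φ : EuclideanSpace ℝ ι => (U'' φ v w - U' φ v * U' φ w)) ((((ContinuousLinearMap.apply ℝ ℝ w).comp (ContinuousLinearMap.apply ℝ
        (EuclideanSpace ℝ ι →L[ℝ] ℝ) v)).comp (U₃ φ)) - (U' φ v • ((ContinuousLinearMap.apply ℝ ℝ w).comp (U'' φ)) + U' φ w •
        ((ContinuousLinearMap.apply ℝ ℝ v).comp (U'' φ)))) φ :=
  (hasFDerivAt_entry_two hU''d v w φ).sub ((hasFDerivAt_entry_one hU'd v φ).mul (hasFDerivAt_entry_one hU'd w φ))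

omit [DecidableEq ι] in
/-- Its growth: `|U″vw − U′vU′w| ≤ (1+2κ₂+κ₃)(1+‖U′‖)²` for `‖v‖, ‖w‖ ≤ 1`. [folklore] -/
theorem abs_obs_two_le (hU''b : ∀ φ : EuclideanSpace ℝ ι, ‖U'' φ‖ ≤ κ₂) (hU₃b : ∀ φ : EuclideanSpace ℝ ι, ‖U₃ φ‖ ≤ κ₃)
    (v w : EuclideanSpace ℝ ι) (hv : ‖v‖ ≤ 1) (hw : ‖w‖ ≤ 1) (φ : EuclideanSpace ℝ ι) :
    |(U'' φ v w - U' φ v * U' φ w)| ≤ (1 + 2 * κ₂ + κ₃) * (1 + ‖U' φ‖) ^ 2 := by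
  have hκ₂ : 0 ≤ κ₂ := (norm_nonneg (U'' φ)).trans (hU''b φ)
  have hκ₃ : 0 ≤ κ₃ := (norm_nonneg (U₃ φ)).trans (hU₃b φ)
  have hN := norm_nonneg (U' φ)
  have h1 : |U'' φ v w| ≤ κ₂ := by
    calc |U'' φ v w| ≤ ‖U'' φ‖ * ‖v‖ * ‖w‖ := abs_entry_two_le _ _ _
      _ ≤ κ₂ * 1 * 1 := by gcongr; exact hU''b φ
      _ = κ₂ := by ring
  have h2 : |U' φ v| ≤ ‖U' φ‖ := (abs_entry_one_le _ _).trans (by nlinarith [norm_nonneg (U' φ)])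
  have h3 : |U' φ w| ≤ ‖U' φ‖ := (abs_entry_one_le _ _).trans (by nlinarith [norm_nonneg (U' φ)])
  have h4 : |U' φ v * U' φ w| ≤ ‖U' φ‖ ^ 2 := by rw [abs_mul, pow_two]; exact mul_le_mul h2 h3 (abs_nonneg _) hN
  calc |(U'' φ v w - U' φ v * U' φ w)| ≤ |U'' φ v w| + |U' φ v * U' φ w| := abs_sub _ _
    _ ≤ κ₂ + ‖U' φ‖ ^ 2 := add_le_add h1 h4
    _ ≤ (1 + 2 * κ₂ + κ₃) * (1 + ‖U' φ‖) ^ 2 := by nlinarith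

omit [DecidableEq ι] in
/-- Its derivative's growth: `‖…‖ ≤ (1+2κ₂+κ₃)(1+‖U′‖)²`. [folklore] -/
theorem norm_obs_two_deriv_le (hU''b : ∀ φ : EuclideanSpace ℝ ι, ‖U'' φ‖ ≤ κ₂) (hU₃b : ∀ φ : EuclideanSpace ℝ ι, ‖U₃ φ‖ ≤ κ₃)
    (v w : EuclideanSpace ℝ ι) (hv : ‖v‖ ≤ 1) (hw : ‖w‖ ≤ 1) (φ : EuclideanSpace ℝ ι) :
    ‖((((ContinuousLinearMap.apply ℝ ℝ w).comp (ContinuousLinearMap.apply ℝ (EuclideanSpace ℝ ι →L[ℝ] ℝ) v)).comp (U₃ φ)) - (U' φ v •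
        ((ContinuousLinearMap.apply ℝ ℝ w).comp (U'' φ)) + U' φ w • ((ContinuousLinearMap.apply ℝ ℝ v).comp (U'' φ))))‖ ≤ (1 + 2 * κ₂ + κ₃) * (1 +
        ‖U' φ‖) ^ 2 := by
  have hκ₂ : 0 ≤ κ₂ := (norm_nonneg (U'' φ)).trans (hU''b φ)
  have hκ₃ : 0 ≤ κ₃ := (norm_nonneg (U₃ φ)).trans (hU₃b φ)
  have hN := norm_nonneg (U' φ)
  have hA : ‖(((ContinuousLinearMap.apply ℝ ℝ w).comp (ContinuousLinearMap.apply ℝ (EuclideanSpace ℝ ι →L[ℝ] ℝ) v)).comp (U₃ φ))‖ ≤ κ₃ := by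
    calc _ ≤ ‖v‖ * ‖w‖ * ‖U₃ φ‖ := norm_eval_comp_two_le _ _ _
      _ ≤ 1 * 1 * κ₃ := by gcongr; exact hU₃b φ
      _ = κ₃ := by ring
  have hB : ‖U' φ v • ((ContinuousLinearMap.apply ℝ ℝ w).comp (U'' φ))‖ ≤ ‖U' φ‖ * κ₂ := by
    rw [norm_smul, Real.norm_eq_abs]
    have h2 : |U' φ v| ≤ ‖U' φ‖ := (abs_entry_one_le _ _).trans (by nlinarith [norm_nonneg (U' φ)])
    have h3 : ‖((ContinuousLinearMap.apply ℝ ℝ w).comp (U'' φ))‖ ≤ κ₂ := (norm_eval_comp_one_le _ _).trans (by nlinarith [hU''b φ, norm_nonneg (U''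
        φ)])
    exact mul_le_mul h2 h3 (norm_nonneg _) hN
  have hC : ‖U' φ w • ((ContinuousLinearMap.apply ℝ ℝ v).comp (U'' φ))‖ ≤ ‖U' φ‖ * κ₂ := by
    rw [norm_smul, Real.norm_eq_abs]
    have h2 : |U' φ w| ≤ ‖U' φ‖ := (abs_entry_one_le _ _).trans (by nlinarith [norm_nonneg (U' φ)])
    have h3 : ‖((ContinuousLinearMap.apply ℝ ℝ v).comp (U'' φ))‖ ≤ κ₂ := (norm_eval_comp_one_le _ _).trans (by nlinarith [hU''b φ, norm_nonneg (U''
        φ)])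
    exact mul_le_mul h2 h3 (norm_nonneg _) hN
  calc ‖((((ContinuousLinearMap.apply ℝ ℝ w).comp (ContinuousLinearMap.apply ℝ (EuclideanSpace ℝ ι →L[ℝ] ℝ) v)).comp (U₃ φ)) - (U' φ v •
      ((ContinuousLinearMap.apply ℝ ℝ w).comp (U'' φ)) + U' φ w • ((ContinuousLinearMap.apply ℝ ℝ v).comp (U'' φ))))‖ ≤ ‖(((ContinuousLinearMap.apply
      ℝ ℝ w).comp (ContinuousLinearMap.apply ℝ (EuclideanSpace ℝ ι →L[ℝ] ℝ) v)).comp (U₃ φ))‖ + ‖U' φ v • ((ContinuousLinearMap.apply ℝ ℝ w).comp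
      (U'' φ)) + U' φ w • ((ContinuousLinearMap.apply ℝ ℝ v).comp (U'' φ))‖ := norm_sub_le _ _
    _ ≤ κ₃ + (‖U' φ‖ * κ₂ + ‖U' φ‖ * κ₂) := add_le_add hA ((norm_add_le _ _).trans (add_le_add hB hC))
    _ ≤ (1 + 2 * κ₂ + κ₃) * (1 + ‖U' φ‖) ^ 2 := by nlinarith [mul_nonneg hN hκ₂, mul_nonneg hN hκ₃, mul_nonneg hN hN]

omit [DecidableEq ι] in
/-- Its derivative is continuous in `φ`. [folklore] -/
theorem continuous_obs_two_deriv (hU'd : ∀ φ : EuclideanSpace ℝ ι, HasFDerivAt U' (U'' φ) φ) (hU''c : Continuous U'') (hU₃c : Continuous U₃)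
    (v w : EuclideanSpace ℝ ι) : Continuous fun φ : EuclideanSpace ℝ ι => ((((ContinuousLinearMap.apply ℝ ℝ w).comp (ContinuousLinearMap.apply ℝ
        (EuclideanSpace ℝ ι →L[ℝ] ℝ) v)).comp (U₃ φ)) - (U' φ v • ((ContinuousLinearMap.apply ℝ ℝ w).comp (U'' φ)) + U' φ w •
        ((ContinuousLinearMap.apply ℝ ℝ v).comp (U'' φ)))) := by
  have hU'c : Continuous U' := continuous_iff_continuousAt.2 fun φ => (hU'd φ).continuousAt
  have h1 : Continuous fun φ : EuclideanSpace ℝ ι => (((ContinuousLinearMap.apply ℝ ℝ w).comp (ContinuousLinearMap.apply ℝ (EuclideanSpace ℝ ι →L[ℝ]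
      ℝ) v)).comp (U₃ φ)) := continuous_const.clm_comp hU₃c
  have h2 : Continuous fun φ : EuclideanSpace ℝ ι => ((ContinuousLinearMap.apply ℝ ℝ w).comp (U'' φ)) := continuous_const.clm_comp hU''c
  have h3 : Continuous fun φ : EuclideanSpace ℝ ι => ((ContinuousLinearMap.apply ℝ ℝ v).comp (U'' φ)) := continuous_const.clm_comp hU''c
  exact h1.sub (((hU'c.clm_apply continuous_const).smul h2).add ((hU'c.clm_apply continuous_const).smul h3))

/-- **`d_m H_{vw}`** for `‖v‖, ‖w‖ ≤ 1`. [folklore] -/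
theorem hasFDerivAt_H_scalar (hΓ : Γ.PosSemidef) (hΓop : (γop • (1 : Matrix ι ι ℝ) - Γ).PosSemidef) (Y : Finset ι)
    (hUd : ∀ φ : EuclideanSpace ℝ ι, HasFDerivAt U (U' φ) φ) (hU'd : ∀ φ : EuclideanSpace ℝ ι, HasFDerivAt U' (U'' φ) φ)
    (hU''d : ∀ φ : EuclideanSpace ℝ ι, HasFDerivAt U'' (U₃ φ) φ) (hU₃c : Continuous U₃) (hκ₀ : 0 ≤ κ₀) (hκ₁ : 0 ≤ κ₁) (ha : 0 ≤ a) (hτ : 0 < τ) (hδ :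
        0 < δ) (hθ1 : θ < 1) (hκθ : (2 * κ₀ * (1 + τ) + 4 * δ) * γop ≤ θ)
    (hstab : ∀ φ : EuclideanSpace ℝ ι, -(κ₀ * ∑ x ∈ Y, φ x ^ 2) ≤ U φ) (hU'b : ∀ φ : EuclideanSpace ℝ ι, ‖U' φ‖ ≤ κ₁ * (a + ∑ x ∈ Y, φ x ^ 2))
    (hU''b : ∀ φ : EuclideanSpace ℝ ι, ‖U'' φ‖ ≤ κ₂) (hU₃b : ∀ φ : EuclideanSpace ℝ ι, ‖U₃ φ‖ ≤ κ₃)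
    (ψ₀ v w : EuclideanSpace ℝ ι) (hv : ‖v‖ ≤ 1) (hw : ‖w‖ ≤ 1) :
    HasFDerivAt (fun ψ : EuclideanSpace ℝ ι => ∫ ω : EuclideanSpace ℝ ι, exp (-U (ω + ψ)) * (U'' (ω + ψ) v w - U' (ω + ψ) v * U' (ω + ψ) w)
        ∂(multivariateGaussian 0 Γ))
      (∫ ω : EuclideanSpace ℝ ι, exp (-U (ω + ψ₀)) • (((((ContinuousLinearMap.apply ℝ ℝ w).comp (ContinuousLinearMap.apply ℝ (EuclideanSpace ℝ ι
          →L[ℝ] ℝ) v)).comp (U₃ (ω + ψ₀))) - (U' (ω + ψ₀) v • ((ContinuousLinearMap.apply ℝ ℝ w).comp (U'' (ω + ψ₀))) + U' (ω + ψ₀) w •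
          ((ContinuousLinearMap.apply ℝ ℝ v).comp (U'' (ω + ψ₀))))) - (U'' (ω + ψ₀) v w - U' (ω + ψ₀) v * U' (ω + ψ₀) w) • U' (ω + ψ₀))
          ∂(multivariateGaussian 0 Γ)) ψ₀ := by
  have hU'c : Continuous U' := continuous_iff_continuousAt.2 fun φ => (hU'd φ).continuousAt
  have hU''c : Continuous U'' := continuous_iff_continuousAt.2 fun φ => (hU''d φ).continuousAt
  exact hasFDerivAt_tilted_moment (p := fun φ => (U'' φ v w - U' φ v * U' φ w)) (p' := fun φ => ((((ContinuousLinearMap.apply ℝ ℝ w).comp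
      (ContinuousLinearMap.apply ℝ (EuclideanSpace ℝ ι →L[ℝ] ℝ) v)).comp (U₃ φ)) - (U' φ v • ((ContinuousLinearMap.apply ℝ ℝ w).comp (U'' φ)) + U' φ
      w • ((ContinuousLinearMap.apply ℝ ℝ v).comp (U'' φ))))) (Cp := 1 + 2 * κ₂ + κ₃) (n := 2) hΓ hΓop Y hUd hU'c
    (fun φ => hasFDerivAt_obs_two hU'd hU''d v w φ) (continuous_obs_two_deriv hU'd hU''c hU₃c v w) hκ₀ hκ₁ ha hτ hδ hθ1 hκθ hstab hU'b
    (fun φ => abs_obs_two_le hU''b hU₃b v w hv hw φ) (fun φ => norm_obs_two_deriv_le hU''b hU₃b v w hv hw φ) ψ₀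

/-- **`(d_m H_{vw}) = ∫e^{−U}(U‴mvw − U′v·U″mw − U′w·U″mv − (U″vw − U′vU′w)·U′m) = Φ_{mvw}`**. [folklore] -/
theorem H_fderiv_apply (hΓ : Γ.PosSemidef) (hΓop : (γop • (1 : Matrix ι ι ℝ) - Γ).PosSemidef) (Y : Finset ι)
    (hUd : ∀ φ : EuclideanSpace ℝ ι, HasFDerivAt U (U' φ) φ) (hU'd : ∀ φ : EuclideanSpace ℝ ι, HasFDerivAt U' (U'' φ) φ)
    (hU''d : ∀ φ : EuclideanSpace ℝ ι, HasFDerivAt U'' (U₃ φ) φ) (hU₃c : Continuous U₃) (hκ₀ : 0 ≤ κ₀) (hκ₁ : 0 ≤ κ₁) (ha : 0 ≤ a) (hτ : 0 < τ) (hδ :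
        0 < δ) (hθ1 : θ < 1) (hκθ : (2 * κ₀ * (1 + τ) + 4 * δ) * γop ≤ θ)
    (hstab : ∀ φ : EuclideanSpace ℝ ι, -(κ₀ * ∑ x ∈ Y, φ x ^ 2) ≤ U φ) (hU'b : ∀ φ : EuclideanSpace ℝ ι, ‖U' φ‖ ≤ κ₁ * (a + ∑ x ∈ Y, φ x ^ 2))
    (hU''b : ∀ φ : EuclideanSpace ℝ ι, ‖U'' φ‖ ≤ κ₂) (hU₃b : ∀ φ : EuclideanSpace ℝ ι, ‖U₃ φ‖ ≤ κ₃)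
    (ψ₀ v w : EuclideanSpace ℝ ι) (hv : ‖v‖ ≤ 1) (hw : ‖w‖ ≤ 1) (m : EuclideanSpace ℝ ι) :
    (∫ ω : EuclideanSpace ℝ ι, exp (-U (ω + ψ₀)) • (((((ContinuousLinearMap.apply ℝ ℝ w).comp (ContinuousLinearMap.apply ℝ (EuclideanSpace ℝ ι →L[ℝ]
        ℝ) v)).comp (U₃ (ω + ψ₀))) - (U' (ω + ψ₀) v • ((ContinuousLinearMap.apply ℝ ℝ w).comp (U'' (ω + ψ₀))) + U' (ω + ψ₀) w •
        ((ContinuousLinearMap.apply ℝ ℝ v).comp (U'' (ω + ψ₀))))) - (U'' (ω + ψ₀) v w - U' (ω + ψ₀) v * U' (ω + ψ₀) w) • U' (ω + ψ₀))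
        ∂(multivariateGaussian 0 Γ)) m =
      ∫ ω : EuclideanSpace ℝ ι, exp (-U (ω + ψ₀)) * (U₃ (ω + ψ₀) m v w - U' (ω + ψ₀) v * U'' (ω + ψ₀) m w - U' (ω + ψ₀) w * U'' (ω + ψ₀) m v -
        (U'' (ω + ψ₀) v w - U' (ω + ψ₀) v * U' (ω + ψ₀) w) * U' (ω + ψ₀) m) ∂(multivariateGaussian 0 Γ) := by
  have hU'c : Continuous U' := continuous_iff_continuousAt.2 fun φ => (hU'd φ).continuousAt
  have hU''c : Continuous U'' := continuous_iff_continuousAt.2 fun φ => (hU''d φ).continuousAt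
  rw [tilted_moment_fderiv_apply (p := fun φ => (U'' φ v w - U' φ v * U' φ w)) (p' := fun φ => ((((ContinuousLinearMap.apply ℝ ℝ w).comp
      (ContinuousLinearMap.apply ℝ (EuclideanSpace ℝ ι →L[ℝ] ℝ) v)).comp (U₃ φ)) - (U' φ v • ((ContinuousLinearMap.apply ℝ ℝ w).comp (U'' φ)) + U' φ
      w • ((ContinuousLinearMap.apply ℝ ℝ v).comp (U'' φ))))) (Cp := 1 + 2 * κ₂ + κ₃) (n := 2) hΓ hΓop Y hUd hU'c
    (fun φ => hasFDerivAt_obs_two hU'd hU''d v w φ) (continuous_obs_two_deriv hU'd hU''c hU₃c v w) hκ₀ hκ₁ ha hτ hδ hθ1 hκθ hstab hU'b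
    (fun φ => abs_obs_two_le hU''b hU₃b v w hv hw φ) (fun φ => norm_obs_two_deriv_le hU''b hU₃b v w hv hw φ) ψ₀ m]
  refine integral_congr_ae (ae_of_all _ fun ω => ?_)
  simp only [ContinuousLinearMap.coe_comp, Function.comp_apply, ContinuousLinearMap.apply_apply, sub_apply, add_apply, smul_apply, smul_eq_mul]
  ring

end TheEnds

/-! ## §4. Toy -/

/-- Toy (the growth letters: `κ₂ ≤ (1+κ₂)(1+N)` for `κ₂, N ≥ 0`). -/
example (κ₂ N : ℝ) (hκ : 0 ≤ κ₂) (hN : 0 ≤ N) : κ₂ ≤ (1 + κ₂) * (1 + N) := by nlinarith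

end Summit.QuantumFields.BalabanUV.T4Continuum.NE7b.SupTiltedMomentConstituents

end
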